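import Literature.AlgebraicGeometry.HodgeTheory.PolarizationClassRosatiAdjoint
import HarnessLib

/-!
# Moonen–Zarhin's Lemma (1), second sentence, for `X ∼ Y^m` with `Y` simple, `m ≥ 2` — both halves, intrinsically:
# `Z(G_div(X)(h_X))(ℂ)` is finite iff `Y` has no factor of type IV iff the centre of `End⁰(Y)` is totally real, and
# is a torus `(ℂ^×)^{e₀}`, `2e₀ = [E:ℚ]`, iff `Y` is of type IV iff the centre is a CM field

Layer `Literature/AlgebraicGeometry/HodgeTheory`; THEOREMS ONLY — no definition, no named fact, no `sorry` (D-0026, net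
debt 0).  Assembly row of the seat's generation 28: the `End(Y)`-level Moonen–Zarhin files of generations 25–27
(`DivisorLefschetzGroupCentreTorus`, `…CentreFinite`, `…CentreUpToIsogeny`, `…CentreFiniteIffNoTypeIVFactor`,
`NoTypeIVFactorIffCentreTotallyReal`) proved the second sentence of Lemma (1) from a DATUM on `Y`: a polarization
class `h` with `L_h^{dim Y - 1} h ≠ 0`, the presentation of the centre of `End⁰(Y)` as `ℚ(ψ)` on `End(Y)`, and the
Rosati image `ψ'` of `ψ`.  For `Y = B` SIMPLE every item of that datum is now a THEOREM of the tree
(`AbelianVariety.exists_polarizationClass_package`, g28-#1; `exists_centre_presentation_End_with_rosati_of_isSimple`,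
g28-#2), so the second sentence of Lemma (1) holds as printed, with no hypothesis on `B` beyond simplicity and
positive dimension: for every `X` isogenous to `B^{n+2}` and every admissible `h_X`,
`Z(G_div(X)(h_X))(ℂ)` is finite ⟺ `B` has no factor of type IV ⟺ `E = Z(End⁰(B))` is totally real, and
`Z(G_div(X)(h_X))(ℂ) ≃ (ℂ^×)^{e₀}` with `2e₀ = [E:ℚ]` ⟺ `B` is of type IV ⟺ `E` is a CM field; with the `m = 1`,
`d ≥ 2` clause (a non-commuting pair in `End(B)`).

## The print

B. J. J. Moonen, Yu. G. Zarhin, *Weil classes on abelian varieties*, J. reine angew. Math. **496** (1998) 83–92 =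
arXiv:alg-geom/9612017 [MoonenZarhin1998WeilClasses] (held text `paper:arxiv-alg-geom_9612017`), §1 (chunk p0002
L45–L51): «we may even assume that `X = Y^m` for some `m ≥ 1`, where `Y` is simple. Let `D = End⁰(Y)`, let `E` be the
center of `D`, and let `E₀` be the maximal totally real subfield of `E`. We write `e₀ = [E₀:ℚ]`, `e = [E:ℚ]` and
`d² = [D:E]` … type 1, 2, 3 or 4 … in the Albert classification»; Lemma (1) (chunk p0002 L121–L127), VERBATIM: «(1)
The center of `G_div(X)` is the group `U_{K_B}` given by `U_{K_B}(R) = {a ∈ (K_B ⊗_ℚ R)^* | a a† = 1}`. For `X` of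
type 4 with either `d ≥ 2` or `m ≥ 2` this is a connected torus of rank `e₀`; in all other cases it is finite.»
(For `E` a CM field `U_E(ℂ) ≃ (ℂ^×)^{e₀}`, `e = 2e₀`; for `E` totally real `U_E = μ₂^{Σ_E}`, of order `2^e`.)
H. Lange, *Abelian Varieties over the Complex Numbers* (2023) [Lange2023AbelianVarietiesC] §2.6 Lemma 2.6.4 /
Lemma 2.6.6 (first kind ⟺ centre totally real; second kind ⟹ centre totally complex); G. Shimura (1998) [Shimura1998]
§5.1 Prop. 5 (the centre of `End_Q(B)`, `B` simple, is totally real or CM).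

## Dictionary

`B` simple of positive dimension, `E = CenterField B` (the centre of `End⁰(B)` as a number field), `X` a complex
abelian variety with `AbelianVariety.IsIsogenous X (⨁_{Fin (n+2)} B)` («`X ∼ Y^m`, `m ≥ 2`»), `h_X ∈ B¹(X) ⊗ ℂ` with
`Q_{h_X}` non-degenerate on `H¹(X(ℂ); ℂ)` («admissible»: every polarization class is), `G_div(X)(h_X)(ℂ) =
divisorLefschetzGroup X h_X` (the seat's `DivisorLefschetzGroup`), `Z(·) = Subgroup.center`; «no factor of type IV» =
the tree's `HasNoTypeIVFactor`; «type IV» = its negation (for simple `B`: `IsCMField E`,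
`not_hasNoTypeIVFactor_iff_isCMField_centerField`).

## What is proved (sorry-free), all for `B` simple, `1 ≤ dim B`, `X ∼ B^{n+2}`, `h_X` admissible

* **`AbelianVariety.IsSimple.finite_center_divisorLefschetzGroup_iff_hasNoTypeIVFactor`** — `Finite Z ↔ HasNoTypeIVFactor B`;
  `….finite_center_divisorLefschetzGroup_iff_isTotallyReal_centerField` — `↔ IsTotallyReal E`;
  `….infinite_center_divisorLefschetzGroup_iff_not_hasNoTypeIVFactor`, `…_iff_isCMField_centerField`;
* **`AbelianVariety.IsSimple.exists_center_divisorLefschetzGroup_mulEquiv_pi_units_of_isCMField_centerField`** —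
  `E` CM ⟹ `∃ e₀, 2e₀ = [E:ℚ] ∧ Z ≃* (ℂ^×)^{e₀}`; `…_of_not_hasNoTypeIVFactor`;
* **`AbelianVariety.IsSimple.center_divisorLefschetzGroup_dichotomy`** — EITHER `E` is totally real and `Z` is a finite
  `2`-group of order `≤ 2^{[E:ℚ]}`, OR `E` is CM and `Z ≃* (ℂ^×)^{e₀}` with `2e₀ = [E:ℚ]`;
* `AbelianVariety.IsSimple.finite_center_divisorLefschetzGroup_iff_hasNoTypeIVFactor_self` — `Finite Z ↔ HasNoTypeIVFactor X`;
* the `m ≥ 1`, `d ≥ 2` clause: `AbelianVariety.IsSimple.exists_center_divisorLefschetzGroup_mulEquiv_pi_units_of_comp_ne`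
  and `….infinite_center_divisorLefschetzGroup_of_isCMField_centerField_of_comp_ne` for `X ∼ B^{n+1}` and a
  non-commuting pair in `End(B)`.

## Honest column

* `G_div(X)` is read, as in all the seat's files, as the carrier group `divisorLefschetzGroup X h_X` of
  `ℂ`-points; «connected torus of rank `e₀`» is rendered as an abstract group isomorphism with `(ℂ^×)^{e₀}` (no
  algebraic-group structure on the carrier).
* The case `m = 1` with `d = 1` (then `G_div(X)` is NOT the commutant group; see `LefschetzGroupCentreInfiniteOfTypeIVFactor`)
  is not covered, exactly as the print's «either `d ≥ 2` or `m ≥ 2`».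

## Provenance

Lane `lit-hodgefound` (Track 2, Layer A), prover seat `lit-hodgefound-p21` (generation 28), row g28-#3.
-/

noncomputable section

open CategoryTheory CategoryTheory.Limits Polynomial Module NumberField
open Literature.AlgebraicTopology.SingularHomology
open Literature.AlgebraicGeometry.Motives
open Literature.AlgebraicGeometry.VanGeemen1994 (hodgeClassSpan pullbackOne)
open Literature.AlgebraicGeometry.Milne1999
open Literature.AlgebraicGeometry.ComplexMultiplication (CenterField center_isTotallyReal_or_isCMField_of_isSimple)
open Literature.Geometry.Kaehler (lefschetzPow HasHardLefschetzProperty)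

namespace Literature.AlgebraicGeometry.Motives.AbelianVariety.IsSimple

open Literature.AlgebraicGeometry.HodgeTheory

variable {B : AbelianVariety ℂ} {n : ℕ}

/-! ### `m ≥ 2`: finite iff no factor of type IV iff the centre is totally real -/

/-- **MOONEN–ZARHIN LEMMA (1), SECOND SENTENCE, `X ∼ Y^m`, `Y = B` SIMPLE, `m ≥ 2`: `Z(G_div(X)(h_X))(ℂ)` IS FINITE iff
`B` HAS NO FACTOR OF TYPE IV** — for every `X` isogenous to `B^{n+2}` and every admissible `h_X`; no further
hypothesis on `B` (the polarization class, the presentation of the centre and its Rosati image are theorems of the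
tree: `exists_polarizationClass_centre_presentation_End_with_rosati_of_isSimple`).
[cite: MoonenZarhin1998WeilClasses, §1 Lemma (1) (chunk p0002 L121–L127) with §1 (chunk p0002 L45–L51)]
[cite: Lange2023AbelianVarietiesC, §2.6 Lemma 2.6.4 and Lemma 2.6.6 (held p0144)] [cite: MumfordAV1970, §20 pp. 189–190] -/
theorem finite_center_divisorLefschetzGroup_iff_hasNoTypeIVFactor (hB : AbelianVariety.IsSimple B) (h1 : 1 ≤ B.dim)
    {X : AbelianVariety ℂ} (hX : AbelianVariety.IsIsogenous X (⨁ (fun _ : Fin (n + 2) => B)))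
    {hX' : complexBetti X.X 2} (hhX : hX' ∈ hodgeClassSpan X.dim X.X 1)
    (hndX : ∀ x : complexBetti X.X 1, (∀ y, polarizationPairingOne X.X hX' (X.dim - 1) x y = 0) → x = 0) :
    Finite (Subgroup.center (divisorLefschetzGroup X hX')) ↔ HasNoTypeIVFactor B := by
  obtain ⟨h, ψ, ψ', R, -, -, -, hposQ, hh, htop, hnd, hψ, hRm, hRirr, hψR, -, hZ, hadj, -, hψ'E⟩ :=
    exists_polarizationClass_centre_presentation_End_with_rosati_of_isSimple hB h1
  exact finite_center_divisorLefschetzGroup_iff_hasNoTypeIVFactor_of_isIsogenous_biproduct_two h1 hh htop hnd hposQ hψ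
    hRm hRirr hψR hadj hψ'E hZ hX hhX hndX

/-- **… iff THE CENTRE OF `End⁰(B)` IS TOTALLY REAL** (types 1–3 as the print defines them).
[cite: MoonenZarhin1998WeilClasses, §1 Lemma (1) (chunk p0002 L121–L127) with §1 (chunk p0002 L45–L51)]
[cite: Lange2023AbelianVarietiesC, §2.6 Lemma 2.6.4 (held p0144)] [cite: Shimura1998, §5.1 Proposition 5 (p. 36)] -/
theorem finite_center_divisorLefschetzGroup_iff_isTotallyReal_centerField (hB : AbelianVariety.IsSimple B)
    (h1 : 1 ≤ B.dim) {X : AbelianVariety ℂ} (hX : AbelianVariety.IsIsogenous X (⨁ (fun _ : Fin (n + 2) => B)))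
    {hX' : complexBetti X.X 2} (hhX : hX' ∈ hodgeClassSpan X.dim X.X 1)
    (hndX : ∀ x : complexBetti X.X 1, (∀ y, polarizationPairingOne X.X hX' (X.dim - 1) x y = 0) → x = 0) :
    Finite (Subgroup.center (divisorLefschetzGroup X hX')) ↔ IsTotallyReal (CenterField B hB h1) :=
  (hB.finite_center_divisorLefschetzGroup_iff_hasNoTypeIVFactor h1 hX hhX hndX).trans
    (hasNoTypeIVFactor_iff_isTotallyReal_centerField hB h1)

/-- **… `Z(G_div(X)(h_X))(ℂ)` IS INFINITE iff `B` HAS A FACTOR OF TYPE IV** (is of type IV).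
[cite: MoonenZarhin1998WeilClasses, §1 Lemma (1) (chunk p0002 L121–L127)] [cite: Lange2023AbelianVarietiesC, §2.6 Lemma 2.6.6 (held p0144)] -/
theorem infinite_center_divisorLefschetzGroup_iff_not_hasNoTypeIVFactor (hB : AbelianVariety.IsSimple B)
    (h1 : 1 ≤ B.dim) {X : AbelianVariety ℂ} (hX : AbelianVariety.IsIsogenous X (⨁ (fun _ : Fin (n + 2) => B)))
    {hX' : complexBetti X.X 2} (hhX : hX' ∈ hodgeClassSpan X.dim X.X 1)
    (hndX : ∀ x : complexBetti X.X 1, (∀ y, polarizationPairingOne X.X hX' (X.dim - 1) x y = 0) → x = 0) :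
    Infinite (Subgroup.center (divisorLefschetzGroup X hX')) ↔ ¬ HasNoTypeIVFactor B := by
  rw [← not_finite_iff_infinite, hB.finite_center_divisorLefschetzGroup_iff_hasNoTypeIVFactor h1 hX hhX hndX]

/-- **… iff THE CENTRE OF `End⁰(B)` IS A CM FIELD** (type 4).
[cite: MoonenZarhin1998WeilClasses, §1 Lemma (1) (chunk p0002 L121–L127) with §1 (chunk p0002 L45–L51)]
[cite: Shimura1998, §5.1 Proposition 5 (p. 36)] [cite: Lange2023AbelianVarietiesC, §2.6 Lemma 2.6.6 (held p0144)] -/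
theorem infinite_center_divisorLefschetzGroup_iff_isCMField_centerField (hB : AbelianVariety.IsSimple B)
    (h1 : 1 ≤ B.dim) {X : AbelianVariety ℂ} (hX : AbelianVariety.IsIsogenous X (⨁ (fun _ : Fin (n + 2) => B)))
    {hX' : complexBetti X.X 2} (hhX : hX' ∈ hodgeClassSpan X.dim X.X 1)
    (hndX : ∀ x : complexBetti X.X 1, (∀ y, polarizationPairingOne X.X hX' (X.dim - 1) x y = 0) → x = 0) :
    Infinite (Subgroup.center (divisorLefschetzGroup X hX')) ↔ IsCMField (CenterField B hB h1) :=
  (hB.infinite_center_divisorLefschetzGroup_iff_not_hasNoTypeIVFactor h1 hX hhX hndX).trans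
    (not_hasNoTypeIVFactor_iff_isCMField_centerField hB h1)

/-- **… and `Z(G_div(X)(h_X))(ℂ)` is finite iff `X` ITSELF has no factor of type IV** («`X` and `Y` are of the same
type»: `hasNoTypeIVFactor_iff_isTotallyReal_centerField_of_isIsogenous_biproduct`).
[cite: MoonenZarhin1998WeilClasses, §1 Lemma (1) (chunk p0002 L121–L127) and «everything only depends on X up to isogeny» (chunk p0002 L45)]
[cite: MoonenZarhin1999LowDim, §1] -/
theorem finite_center_divisorLefschetzGroup_iff_hasNoTypeIVFactor_self (hB : AbelianVariety.IsSimple B)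
    (h1 : 1 ≤ B.dim) {X : AbelianVariety ℂ} (hX : AbelianVariety.IsIsogenous X (⨁ (fun _ : Fin (n + 2) => B)))
    {hX' : complexBetti X.X 2} (hhX : hX' ∈ hodgeClassSpan X.dim X.X 1)
    (hndX : ∀ x : complexBetti X.X 1, (∀ y, polarizationPairingOne X.X hX' (X.dim - 1) x y = 0) → x = 0) :
    Finite (Subgroup.center (divisorLefschetzGroup X hX')) ↔ HasNoTypeIVFactor X := by
  rw [hB.finite_center_divisorLefschetzGroup_iff_isTotallyReal_centerField h1 hX hhX hndX,
    hasNoTypeIVFactor_iff_isTotallyReal_centerField_of_isIsogenous_biproduct hB h1 hX]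

/-! ### `m ≥ 2`, type IV: the torus of rank `e₀` -/

/-- **MOONEN–ZARHIN LEMMA (1), «FOR `X` OF TYPE 4 WITH `m ≥ 2` THIS IS A CONNECTED TORUS OF RANK `e₀`», `Y = B` SIMPLE,
INTRINSIC FORM**: if the centre `E` of `End⁰(B)` is a CM field then for every `X ∼ B^{n+2}` and every admissible `h_X`
there is `e₀` with `2 e₀ = [E:ℚ]` and `Z(G_div(X)(h_X))(ℂ) ≃ (ℂ^×)^{e₀}` (`= U_E(ℂ)`, `e₀ = [E₀:ℚ]`).
[cite: MoonenZarhin1998WeilClasses, §1 Lemma (1) (chunk p0002 L121–L127) with §1 (chunk p0002 L45–L51) and L83–L85]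
[cite: Milne1999LefschetzClasses, §1 pp. 643–644, §2 pp. 645–651] [cite: MumfordAV1970, §20 pp. 189–190] -/
theorem exists_center_divisorLefschetzGroup_mulEquiv_pi_units_of_isCMField_centerField (hB : AbelianVariety.IsSimple B)
    (h1 : 1 ≤ B.dim) (hK : IsCMField (CenterField B hB h1))
    {X : AbelianVariety ℂ} (hX : AbelianVariety.IsIsogenous X (⨁ (fun _ : Fin (n + 2) => B)))
    {hX' : complexBetti X.X 2} (hhX : hX' ∈ hodgeClassSpan X.dim X.X 1)
    (hndX : ∀ x : complexBetti X.X 1, (∀ y, polarizationPairingOne X.X hX' (X.dim - 1) x y = 0) → x = 0) :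
    ∃ e₀ : ℕ, 2 * e₀ = Module.finrank ℚ (CenterField B hB h1) ∧
      Nonempty (Subgroup.center (divisorLefschetzGroup X hX') ≃* (Fin e₀ → ℂˣ)) := by
  obtain ⟨h, ψ, ψ', R, -, -, -, hposQ, hh, htop, hnd, hψ, hRm, hRirr, hψR, hdeg, hZ, hadj, -, hψ'E⟩ :=
    exists_polarizationClass_centre_presentation_End_with_rosati_of_isSimple hB h1
  have hne : ψ' ≠ ψ := (adjoint_ne_iff_not_hasNoTypeIVFactor h1 hnd hposQ hψ hRm hRirr hψR hadj hψ'E hZ).2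
    ((not_hasNoTypeIVFactor_iff_isCMField_centerField hB h1).2 hK)
  rw [← hdeg]
  exact exists_nonempty_center_divisorLefschetzGroup_mulEquiv_pi_units_of_isIsogenous_biproduct_two_of_CMCentre_End h1 hh
    htop hnd hψ hRm hRirr hψR hadj hψ'E hne hZ hX hhX hndX

/-- **… the same from «`B` has a factor of type IV»** (`¬ HasNoTypeIVFactor B`).
[cite: MoonenZarhin1998WeilClasses, §1 Lemma (1) (chunk p0002 L121–L127)] [cite: Lange2023AbelianVarietiesC, §2.6 Lemma 2.6.6 (held p0144)] -/
theorem exists_center_divisorLefschetzGroup_mulEquiv_pi_units_of_not_hasNoTypeIVFactor (hB : AbelianVariety.IsSimple B)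
    (h1 : 1 ≤ B.dim) (h4 : ¬ HasNoTypeIVFactor B)
    {X : AbelianVariety ℂ} (hX : AbelianVariety.IsIsogenous X (⨁ (fun _ : Fin (n + 2) => B)))
    {hX' : complexBetti X.X 2} (hhX : hX' ∈ hodgeClassSpan X.dim X.X 1)
    (hndX : ∀ x : complexBetti X.X 1, (∀ y, polarizationPairingOne X.X hX' (X.dim - 1) x y = 0) → x = 0) :
    ∃ e₀ : ℕ, 2 * e₀ = Module.finrank ℚ (CenterField B hB h1) ∧
      Nonempty (Subgroup.center (divisorLefschetzGroup X hX') ≃* (Fin e₀ → ℂˣ)) :=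
  hB.exists_center_divisorLefschetzGroup_mulEquiv_pi_units_of_isCMField_centerField h1
    ((not_hasNoTypeIVFactor_iff_isCMField_centerField hB h1).1 h4) hX hhX hndX

/-- **MOONEN–ZARHIN LEMMA (1), SECOND SENTENCE, AS A DICHOTOMY ON THE CENTRE `E` OF `End⁰(B)`** (`B` simple, `X ∼ B^{n+2}`,
`h_X` admissible): EITHER `E` is totally real and `Z(G_div(X)(h_X))(ℂ)` is a finite group of involutions of order
`≤ 2^{[E:ℚ]}` («in all other cases it is finite»; `U_E = μ₂^{Σ_E}`), OR `E` is a CM field and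
`Z(G_div(X)(h_X))(ℂ) ≃ (ℂ^×)^{e₀}` with `2 e₀ = [E:ℚ]` («a connected torus of rank `e₀`») — Shimura's alternative for
the centre (`ComplexMultiplication.center_isTotallyReal_or_isCMField_of_isSimple`) decides which.
[cite: MoonenZarhin1998WeilClasses, §1 Lemma (1) (chunk p0002 L121–L127) with §1 (chunk p0002 L45–L51)]
[cite: Shimura1998, §5.1 Proposition 5 (p. 36)] [cite: Lange2023AbelianVarietiesC, §2.6 Lemma 2.6.4 and Lemma 2.6.6 (held p0144)] -/
theorem center_divisorLefschetzGroup_dichotomy (hB : AbelianVariety.IsSimple B) (h1 : 1 ≤ B.dim)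
    {X : AbelianVariety ℂ} (hX : AbelianVariety.IsIsogenous X (⨁ (fun _ : Fin (n + 2) => B)))
    {hX' : complexBetti X.X 2} (hhX : hX' ∈ hodgeClassSpan X.dim X.X 1)
    (hndX : ∀ x : complexBetti X.X 1, (∀ y, polarizationPairingOne X.X hX' (X.dim - 1) x y = 0) → x = 0) :
    (IsTotallyReal (CenterField B hB h1) ∧ (∀ z ∈ Subgroup.center (divisorLefschetzGroup X hX'), z * z = 1) ∧
        Finite (Subgroup.center (divisorLefschetzGroup X hX')) ∧
        Nat.card (Subgroup.center (divisorLefschetzGroup X hX')) ≤ 2 ^ Module.finrank ℚ (CenterField B hB h1)) ∨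
      (IsCMField (CenterField B hB h1) ∧ ∃ e₀ : ℕ, 2 * e₀ = Module.finrank ℚ (CenterField B hB h1) ∧
        Nonempty (Subgroup.center (divisorLefschetzGroup X hX') ≃* (Fin e₀ → ℂˣ))) := by
  rcases center_isTotallyReal_or_isCMField_of_isSimple hB h1 with hK | hK
  · exact Or.inl ⟨hK, hB.center_divisorLefschetzGroup_involutive_finite_card_le_of_isTotallyReal_centerField h1 hK hX
      hhX hndX⟩
  · exact Or.inr ⟨hK, hB.exists_center_divisorLefschetzGroup_mulEquiv_pi_units_of_isCMField_centerField h1 hK hX hhX hndX⟩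

/-! ### `m ≥ 1`, type IV with `d ≥ 2`: a non-commuting pair in `End(B)` -/

/-- **MOONEN–ZARHIN LEMMA (1), «FOR `X` OF TYPE 4 WITH `d ≥ 2` THIS IS A CONNECTED TORUS OF RANK `e₀`», `Y = B` SIMPLE, ANY
`m ≥ 1`, INTRINSIC FORM**: if the centre `E` of `End⁰(B)` is a CM field and `End(B)` is not commutative (a pair
`α ≫ β ≠ β ≫ α`, i.e. `d ≥ 2`), then for every `X ∼ B^{n+1}` (including `X ∼ B`) and every admissible `h_X`,
`Z(G_div(X)(h_X))(ℂ) ≃ (ℂ^×)^{e₀}` with `2 e₀ = [E:ℚ]`.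
[cite: MoonenZarhin1998WeilClasses, §1 Lemma (1) (chunk p0002 L121–L127) with §1 (chunk p0002 L45–L48)]
[cite: Milne1999LefschetzClasses, §1 pp. 643–644, §2 pp. 645–651] -/
theorem exists_center_divisorLefschetzGroup_mulEquiv_pi_units_of_isCMField_centerField_of_comp_ne
    (hB : AbelianVariety.IsSimple B) (h1 : 1 ≤ B.dim) (hK : IsCMField (CenterField B hB h1))
    {α β : B ⟶ B} (hαβ : α ≫ β ≠ β ≫ α)
    {X : AbelianVariety ℂ} (hX : AbelianVariety.IsIsogenous X (⨁ (fun _ : Fin (n + 1) => B)))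
    {hX' : complexBetti X.X 2} (hhX : hX' ∈ hodgeClassSpan X.dim X.X 1)
    (hndX : ∀ x : complexBetti X.X 1, (∀ y, polarizationPairingOne X.X hX' (X.dim - 1) x y = 0) → x = 0) :
    ∃ e₀ : ℕ, 2 * e₀ = Module.finrank ℚ (CenterField B hB h1) ∧
      Nonempty (Subgroup.center (divisorLefschetzGroup X hX') ≃* (Fin e₀ → ℂˣ)) := by
  obtain ⟨h, ψ, ψ', R, -, -, -, hposQ, hh, htop, hnd, hψ, hRm, hRirr, hψR, hdeg, hZ, hadj, -, hψ'E⟩ :=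
    exists_polarizationClass_centre_presentation_End_with_rosati_of_isSimple hB h1
  have hne : ψ' ≠ ψ := (adjoint_ne_iff_not_hasNoTypeIVFactor h1 hnd hposQ hψ hRm hRirr hψR hadj hψ'E hZ).2
    ((not_hasNoTypeIVFactor_iff_isCMField_centerField hB h1).2 hK)
  rw [← hdeg]
  exact exists_nonempty_center_divisorLefschetzGroup_mulEquiv_pi_units_of_isIsogenous_biproduct_of_CMCentre_End_of_comp_ne
    h1 hh htop hnd hψ hRm hRirr hψR hadj hψ'E hne hZ hαβ hX hhX hndX

/-- **… in particular `Z(G_div(X)(h_X))(ℂ)` is infinite** for `X ∼ B^{n+1}`, `B` simple of type IV with `End(B)`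
non-commutative. [cite: MoonenZarhin1998WeilClasses, §1 Lemma (1) (chunk p0002 L121–L127)] [cite: Lange2023AbelianVarietiesC, §2.6 Lemma 2.6.6 (held p0144)] -/
theorem infinite_center_divisorLefschetzGroup_of_isCMField_centerField_of_comp_ne (hB : AbelianVariety.IsSimple B)
    (h1 : 1 ≤ B.dim) (hK : IsCMField (CenterField B hB h1)) {α β : B ⟶ B} (hαβ : α ≫ β ≠ β ≫ α)
    {X : AbelianVariety ℂ} (hX : AbelianVariety.IsIsogenous X (⨁ (fun _ : Fin (n + 1) => B)))
    {hX' : complexBetti X.X 2} (hhX : hX' ∈ hodgeClassSpan X.dim X.X 1)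
    (hndX : ∀ x : complexBetti X.X 1, (∀ y, polarizationPairingOne X.X hX' (X.dim - 1) x y = 0) → x = 0) :
    Infinite (Subgroup.center (divisorLefschetzGroup X hX')) := by
  obtain ⟨h, ψ, ψ', R, -, -, -, hposQ, hh, htop, hnd, hψ, hRm, hRirr, hψR, -, hZ, hadj, -, hψ'E⟩ :=
    exists_polarizationClass_centre_presentation_End_with_rosati_of_isSimple hB h1
  exact infinite_center_divisorLefschetzGroup_of_not_hasNoTypeIVFactor_of_isIsogenous_biproduct_of_comp_ne h1 hh htop hnd
    hposQ hψ hRm hRirr hψR hadj hψ'E hZ ((not_hasNoTypeIVFactor_iff_isCMField_centerField hB h1).2 hK) hαβ hX hhX hndX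

/-! ### The powers `B^{n+2}` themselves -/

/-- **Lemma (1), second sentence, for `X = B^{n+2}` itself** with any admissible class: `Finite Z ↔ IsTotallyReal E`.
[cite: MoonenZarhin1998WeilClasses, §1 Lemma (1) (chunk p0002 L121–L127)] -/
theorem finite_center_divisorLefschetzGroup_biproduct_iff_isTotallyReal_centerField (hB : AbelianVariety.IsSimple B)
    (h1 : 1 ≤ B.dim) {hX' : complexBetti (⨁ (fun _ : Fin (n + 2) => B)).X 2}
    (hhX : hX' ∈ hodgeClassSpan (⨁ (fun _ : Fin (n + 2) => B)).dim (⨁ (fun _ : Fin (n + 2) => B)).X 1)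
    (hndX : ∀ x : complexBetti (⨁ (fun _ : Fin (n + 2) => B)).X 1,
      (∀ y, polarizationPairingOne (⨁ (fun _ : Fin (n + 2) => B)).X hX' ((⨁ (fun _ : Fin (n + 2) => B)).dim - 1) x y =
        0) → x = 0) :
    Finite (Subgroup.center (divisorLefschetzGroup (⨁ (fun _ : Fin (n + 2) => B)) hX')) ↔
      IsTotallyReal (CenterField B hB h1) :=
  hB.finite_center_divisorLefschetzGroup_iff_isTotallyReal_centerField h1 (AbelianVariety.IsIsogenous.refl _) hhX hndX

end Literature.AlgebraicGeometry.Motives.AbelianVariety.IsSimple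

end
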